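import Mathlib.Algebra.Star.StarAlgHom
import Mathlib.Algebra.Star.Subalgebra
import Mathlib.Analysis.Calculus.Deriv.Basic
import Literature.MathematicalPhysics.QuantumLattice.SpinSystem
import Literature.MathematicalPhysics.QuantumLattice.LocalDynamics
import Literature.MathematicalPhysics.QuantumLattice.CStarState
import Literature.MathematicalPhysics.QuantumLattice.InfiniteVolumeStates
import Literature.Analysis.UnboundedOperators.SpectralGap
import Literature.Analysis.UnboundedOperators.UnitaryRep
import HarnessLib

-- provenance: harness21/H21/H21/Prelude/QLatticeAQFT/QuasiLocalAlgebra.lean @ acfe20e (interim HEAD d8f2665); M5 mechanical rewrite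
/-!
# The quasi-local C⋆-algebra of a quantum spin system (trunk QLatticeAQFT, item Q15; tier L)

Notions `quasi_local_algebra` and `cstar_state_gns`. The quasi-local algebra of the spin system
on `ℤ^d` with local dimension `q` is the C⋆-inductive limit (UHF algebra)
`𝔄 = closure (⋃_Λ 𝔄_Λ)`, `𝔄_Λ = Op ↥Λ q = B(⨂_{x∈Λ} ℂ^q)`, `Λ ⊆ ℤ^d` finite
(Bratteli–Robinson I §2.6, II §6.2.1; Glimm 1960). Mathlib (pinned) has no C⋆-inductive limits
and no UHF algebras (`rg -i "quasi.?local|UHF|inductive limit" Mathlib/Analysis/CStarAlgebra`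
finds nothing), so following outline Q-D3/A-D5 the quasi-local algebra is a **hypothesis
structure** `QuasiLocalAlgebra d q` with *real* fields: a unital C⋆-algebra `carrier` (Mathlib
`CStarAlgebra` + `StarOrderedRing`, as in item Q12 `CStarState`), unital ⋆-monomorphisms
`ι Λ : 𝔄_Λ →⋆ₐ[ℂ] carrier` compatible with isotony (`embedOp`, item Q3), commuting on disjoint
regions, with dense union of ranges, and the lattice translations `shift v` as ⋆-automorphisms.
Its existence is the sorried theorem `nonempty_quasiLocalAlgebra`.

Contents:
* `QuasiLocalAlgebra d q`, `QuasiLocalAlgebra.localAlgebra` (the ⋆-subalgebra of strictly local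
  elements), `QuasiLocalAlgebra.IsTranslationInvariant`;
* states: `State.toInfVolState` (a **real** definition: `ω ↦ (ω ∘ ι Λ)_Λ`, item Q13
  `InfVolState`), `existsUnique_state_of_infVolState` (the correspondence is bijective);
* dynamics: `IsAutomorphismGroup τ` (strongly continuous one-parameter group of ⋆-automorphisms of
  a C⋆-algebra), `QuasiLocalAlgebra.IsDynamicsOf τ Φ R` (its generator is `derivation Φ R` on
  local elements), `exists_dynamics` (BR II Thm. 6.2.4);
* ground states: `ω.IsGroundState τ` (`-i ω(A⋆ δ(A)) ≥ 0`, BR II Def. 5.3.18),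
  `State.isGroundState_iff_toInfVolState_isGroundState` (for bounded finite-range `Φ`, where
  `𝔄_loc` is a core for the generator), `State.IsGNSImplementationOf ω τ U`
  (`π_ω(τ_t(A)) = U(t) π_ω(A) U(t)⋆`, `U(t) Ω_ω = Ω_ω`), `exists_gnsHamiltonian` (BR II
  Cor. 5.3.20 / Prop. 5.3.19), and the bridge `isGappedGroundState_iff_hasGroundStateGap` between
  the local gap criterion `InfVolState.IsGappedGroundState` (item Q13) and G07's
  `LinearPMap.HasGroundStateGap` for the GNS Hamiltonian `U.hamiltonian` (item C4 `UnitaryRep`).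
  This is where the GNS clause of hubbard.S22 and the notion `cstar_state_gns` meet the lattice.

## Sources

* O. Bratteli, D. W. Robinson, *Operator Algebras and Quantum Statistical Mechanics I* (2nd ed.,
  Springer 1987), §2.6 (quasi-local algebras), Example 2.6.13/§2.6.3 (UHF algebras), Cor. 2.3.17
  (unitary implementation of automorphisms leaving a state invariant).
* O. Bratteli, D. W. Robinson, *Operator Algebras and Quantum Statistical Mechanics II* (2nd ed.,
  Springer 1997), §6.2.1 (quantum spin systems), Thm. 6.2.4 (existence of the dynamics for
  `‖Φ‖_λ < ∞`, in particular bounded finite range), Def. 5.3.18, Prop. 5.3.19, Cor. 5.3.20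
  (ground states, GNS Hamiltonian `H_ω ≥ 0`, `H_ω Ω_ω = 0`), §6.2.7.
* J. Glimm, *On a certain class of operator algebras*, Trans. AMS 95 (1960) 318–340 (UHF).
* H. Tasaki, *Physics and Mathematics of Quantum Many-Body Systems* (Springer 2020), App. A.7,
  Def. A.16, Lemma A.17 (gapped ground state ⇔ spectral gap of the GNS Hamiltonian).

## Mathlib search and design notes

* Used from Mathlib: `CStarAlgebra`, `StarOrderedRing`, `StarAlgHom` (`→⋆ₐ[ℂ]`), `StarAlgEquiv`
  (`≃⋆ₐ[ℂ]`), `StarAlgHom.range : StarSubalgebra`, `Dense`, `HasDerivAt` (the carrier is a real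
  normed space through `NormedSpace.complexToReal`), `PositiveLinearMap.GNS`/`gnsStarAlgHom`
  (through item Q12's `State.gnsSpace`, `State.gnsRep`, `State.gnsVector`).
* `carrier : Type` (universe `0`), as in the outline; the instances are structure fields made
  instances by `attribute [instance]`.
* `QuasiLocalAlgebra d 0` is empty (`Op ↥Λ 0` is the zero ring for `Λ ≠ ∅` but `ℂ` for `Λ = ∅`,
  and `ι` is injective and unital), so `nonempty_quasiLocalAlgebra` assumes `[NeZero q]`.
* `ω.IsGroundState τ` only refers to `τ` (not to `Φ`): `A ∈ D(δ)` is spelled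
  "`t ↦ τ_t(A)` has a derivative `δA` at `0`", exactly BR II Def. 5.3.18 with `δ` the generator.
* Sign conventions: `τ_t(A) = e^{itH} A e^{-itH}`, `δ(A) = i[H, A]` (item Q13 `derivation`),
  `U(t) = e^{itH_ω}` (item C4 `UnitaryRep.hamiltonian`), so a ground state has `H_ω ≥ 0`.
-/

noncomputable section

open Matrix Complex Finset Filter Topology
open scoped Matrix.Norms.L2Operator ComplexOrder InnerProductSpace

namespace Literature.MathematicalPhysics.QuantumLattice

/-! ### One-parameter automorphism groups of a C⋆-algebra -/

section CStar

variable {A : Type*} [CStarAlgebra A]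

/-- `τ : ℝ → Aut(A)` is a **strongly continuous one-parameter group of ⋆-automorphisms** of the
C⋆-algebra `A`: `τ₀ = id`, `τ_{s+t} = τ_s ∘ τ_t`, and `t ↦ τ_t(a)` is (norm-)continuous for
every `a` (a *C⋆-dynamical system*). Bratteli–Robinson I Def. 2.7.1; Bratteli–Robinson II
§5.3.1, §6.2.1. [folklore] -/
def IsAutomorphismGroup (τ : ℝ → (A ≃⋆ₐ[ℂ] A)) : Prop :=
  τ 0 = StarAlgEquiv.refl (R := ℂ) (A := A) ∧ (∀ s t : ℝ, τ (s + t) = (τ t).trans (τ s)) ∧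
    ∀ a : A, Continuous fun t : ℝ => τ t a

section GroundState

variable [PartialOrder A]

/-- `ω` is a **ground state** (C⋆-algebraic definition) for the dynamics `τ`: for every `a` in
the domain of the generator `δ` of `τ`, i.e. whenever `t ↦ τ_t(a)` has a derivative `δa` at
`t = 0`, one has `-i ω(a⋆ δa) ≥ 0` (in `ComplexOrder`: real part `≥ 0`, imaginary part `0`).
Bratteli–Robinson II Def. 5.3.18 (with `β = +∞`) and Prop. 5.3.19. (Dot-namespaced on
`Literature.MathematicalPhysics.QuantumLattice.State`; coexists with the local criterion `InfVolState.IsGroundState` of item Q13. The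
outline calls this predicate `IsGroundStateC`.) [folklore] -/
def State.IsGroundState (ω : State A) (τ : ℝ → (A ≃⋆ₐ[ℂ] A)) : Prop :=
  ∀ (a δa : A), HasDerivAt (fun t : ℝ => τ t a) δa 0 → 0 ≤ -I * ω (star a * δa)

/-- A ground state is invariant under the dynamics: `ω ∘ τ_t = ω`.
Bratteli–Robinson II Prop. 5.3.19 (ground states are `τ`-invariant).
[cite: BratteliRobinsonII1997, Prop. 5.3.19] -/
def State.IsGroundState.apply_dynamics : Prop :=
  ∀ {τ : ℝ → (A ≃⋆ₐ[ℂ] A)} (hτ : IsAutomorphismGroup τ) {ω : State A} (hω : ω.IsGroundState τ) (t : ℝ) (a : A),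
    ω (τ t a) = ω a

end GroundState

variable [PartialOrder A] [StarOrderedRing A]

/-- The strongly continuous one-parameter unitary group `U` on the GNS space `𝓗_ω` **implements**
the dynamics `τ` in the GNS representation and fixes the cyclic vector:
`π_ω(τ_t(a)) = U(t) π_ω(a) U(t)⋆` and `U(t) Ω_ω = Ω_ω` for all `t`. Such a `U` exists (uniquely)
for every `τ`-invariant state. Bratteli–Robinson I Cor. 2.3.17; Bratteli–Robinson II
Prop. 5.3.19 / Cor. 5.3.20 (`U_ω(t) = e^{itH_ω}`). [folklore] -/
def State.IsGNSImplementationOf (ω : State A) (τ : ℝ → (A ≃⋆ₐ[ℂ] A))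
    (U : Literature.Analysis.UnboundedOperators.OneParameterUnitaryGroup ω.gnsSpace) : Prop :=
  (∀ (t : ℝ) (a : A), ω.gnsRep (τ t a) = U.appReal t * ω.gnsRep a * star (U.appReal t)) ∧
    ∀ t : ℝ, U.appReal t ω.gnsVector = ω.gnsVector

end CStar

section QLattice

open Literature.Probability.LatticeModels
open Literature.Probability.LatticeModels (Site)

/-! ### The quasi-local algebra -/

/-- The **quasi-local algebra** of the quantum spin system on `ℤ^d` with local dimension `q`, as a
hypothesis structure: a unital C⋆-algebra `carrier` together with unital ⋆-monomorphisms
`ι Λ : 𝔄_Λ = Op ↥Λ q → carrier` of the local matrix algebras, compatible with isotony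
(`ι Λ' (A ⊗ 𝟙) = ι Λ A`), commuting on disjoint regions (locality), with norm-dense union of
ranges, and carrying the lattice translations as ⋆-automorphisms `shift v` acting on local
elements by transport of regions. Any two such are canonically isomorphic (universal property of
the C⋆-inductive limit); existence is `nonempty_quasiLocalAlgebra`.
Bratteli–Robinson I §2.6 (Def. 2.6.3, quasi-local algebra), Bratteli–Robinson II §6.2.1,
eqs. (6.2.1)–(6.2.2); Glimm (1960). [cite: Glimm1960] -/
structure QuasiLocalAlgebra (d q : ℕ) where
  /-- The underlying type of the C⋆-algebra `𝔄`. -/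
  carrier : Type
  /-- `𝔄` is a unital C⋆-algebra. -/
  [cstar : CStarAlgebra carrier]
  /-- The order on `𝔄` (positive cone). -/
  [po : PartialOrder carrier]
  /-- The order on `𝔄` is the C⋆-order `a ≤ b ↔ b - a ∈ closure {s⋆s}`. -/
  [sor : StarOrderedRing carrier]
  /-- The embeddings `ι_Λ : 𝔄_Λ →⋆ₐ[ℂ] 𝔄` of the local algebras. -/
  ι : (Λ : Finset (Site d)) → (Op ↥Λ q →⋆ₐ[ℂ] carrier)
  /-- Each `ι_Λ` is injective. -/
  ι_injective : ∀ Λ : Finset (Site d), Function.Injective (ι Λ)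
  /-- Compatibility with isotony: `ι_{Λ'} (A ⊗ 𝟙_{Λ'∖Λ}) = ι_Λ (A)` for `Λ ⊆ Λ'`. -/
  ι_compatible : ∀ ⦃Λ Λ' : Finset (Site d)⦄ (h : Λ ⊆ Λ') (A : Op ↥Λ q),
    ι Λ' (embedOp h A) = ι Λ A
  /-- Locality: observables localised in disjoint regions commute. (Redundant given
  `ι_compatible` — both sides embed into `Op ↥(Λ ∪ Λ') q`, where the images commute — but kept
  as a field for convenience, as in the outline.) -/
  ι_commute_of_disjoint : ∀ ⦃Λ Λ' : Finset (Site d)⦄, Disjoint Λ Λ' →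
    ∀ (A : Op ↥Λ q) (B : Op ↥Λ' q), Commute (ι Λ A) (ι Λ' B)
  /-- The strictly local elements `⋃_Λ ι_Λ(𝔄_Λ)` are norm dense in `𝔄`. -/
  dense_range : Dense (⋃ Λ : Finset (Site d), Set.range (ι Λ))
  /-- The lattice translations `τ_v ∈ Aut(𝔄)`, `v ∈ ℤ^d`. -/
  shift : Site d → (carrier ≃⋆ₐ[ℂ] carrier)
  /-- Translations act on local elements by transport of regions:
  `τ_v (ι_Λ A) = ι_{Λ+v} (A relabelled along x ↦ x + v)`. -/
  shift_ι : ∀ (v : Site d) (Λ : Finset (Site d)) (A : Op ↥Λ q),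
    shift v (ι Λ A) = ι (Λ.map (Site.shift v).toEmbedding)
      (transportOp (finsetMapEquiv (Site.shift v).toEmbedding Λ) A)

attribute [instance] QuasiLocalAlgebra.cstar QuasiLocalAlgebra.po QuasiLocalAlgebra.sor

variable {d q : ℕ}

namespace QuasiLocalAlgebra

variable (𝔄 : QuasiLocalAlgebra d q)

/-- The ⋆-subalgebra `𝔄_loc = ⋃_Λ ι_Λ(𝔄_Λ)` of **strictly local** elements (the union is
directed, hence a subalgebra; we take the supremum of the ranges). Bratteli–Robinson II §6.2.1;
Bratteli–Robinson I Def. 2.6.3. [folklore] -/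
def localAlgebra : StarSubalgebra ℂ 𝔄.carrier :=
  ⨆ Λ : Finset (Site d), (𝔄.ι Λ).range

/-- Local elements belong to the local algebra. Bratteli–Robinson II §6.2.1. [folklore] -/
theorem ι_mem_localAlgebra (Λ : Finset (Site d)) (A : Op ↥Λ q) : 𝔄.ι Λ A ∈ 𝔄.localAlgebra :=
  (le_iSup (fun Λ' : Finset (Site d) => (𝔄.ι Λ').range) Λ) ⟨A, rfl⟩

/-- The local algebra is exactly the union of the ranges of the `ι_Λ` (the system is directed
under isotony). Bratteli–Robinson I Def. 2.6.3; Bratteli–Robinson II §6.2.1.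
[cite: BratteliRobinsonII1997, §6.2.1] -/
def coe_localAlgebra : Prop :=
  (𝔄.localAlgebra : Set 𝔄.carrier) = ⋃ Λ : Finset (Site d), Set.range (𝔄.ι Λ)

/-- The local algebra is norm dense in `𝔄`. Bratteli–Robinson II §6.2.1. [folklore] -/
def dense_localAlgebra : Prop :=
  Dense (𝔄.localAlgebra : Set 𝔄.carrier)

/- interim proof relied on results that are now named facts (D-0014); demoted to a fact by the M5 import, proof preserved:
:= by
  rw [coe_localAlgebra]; exact 𝔄.dense_range
-/

/-- Translations compose: `τ_v ∘ τ_w = τ_{v+w}` on `𝔄` (from `shift_ι` on the dense local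
algebra and continuity of ⋆-automorphisms). Bratteli–Robinson II §6.2.1, eq. (6.2.2).
[cite: BratteliRobinsonII1997, §6.2.1 eq. (6.2.2)] -/
def shift_add_apply : Prop :=
  ∀ (v w : Site d) (a : 𝔄.carrier),
    𝔄.shift (v + w) a = 𝔄.shift v (𝔄.shift w a)

/-- A state `ω` on the quasi-local algebra is **translation invariant**: `ω ∘ τ_v = ω` for all
`v ∈ ℤ^d`. Bratteli–Robinson II §6.2.1, §6.2.2 (translation-invariant states).
(Dot-namespaced; coexists with `InfVolState.IsTranslationInvariant`.) [folklore] -/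
def IsTranslationInvariant (ω : State 𝔄.carrier) : Prop :=
  ∀ (v : Site d) (a : 𝔄.carrier), ω (𝔄.shift v a) = ω a

end QuasiLocalAlgebra

/-! ### States on `𝔄` and infinite-volume states -/

/-- The **infinite-volume state** (compatible family of local states, item Q13) of a state `ω` on
the quasi-local algebra: `ω_Λ = ω ∘ ι_Λ`. Normalisation, positivity (`ι_Λ(AᴴA) = (ι_Λ A)⋆ ι_Λ A`)
and compatibility (`ι_compatible`) are proved. Bratteli–Robinson II §6.2.1. [folklore] -/
def State.toInfVolState {𝔄 : QuasiLocalAlgebra d q} (ω : State 𝔄.carrier) :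
    InfVolState d q where
  expect Λ := (ω.toPositiveLinearMap : 𝔄.carrier →ₗ[ℂ] ℂ) ∘ₗ (𝔄.ι Λ).toLinearMap
  expect_one Λ := by simp
  expect_nonneg Λ A := by
    simp only [LinearMap.coe_comp, Function.comp_apply]
    change 0 ≤ ω (𝔄.ι Λ (Aᴴ * A))
    rw [← Matrix.star_eq_conjTranspose, map_mul, map_star]
    exact ω.map_nonneg (star_mul_self_nonneg _)
  compatible Λ Λ' h A := by
    simp only [LinearMap.coe_comp, Function.comp_apply]
    change ω (𝔄.ι Λ' (embedOp h A)) = ω (𝔄.ι Λ A)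
    rw [𝔄.ι_compatible h A]

/-- The local expectations of `ω.toInfVolState` (definitional). Bratteli–Robinson II §6.2.1.
[folklore] -/
@[simp]
theorem State.toInfVolState_expect {𝔄 : QuasiLocalAlgebra d q} (ω : State 𝔄.carrier)
    (Λ : Finset (Site d)) (A : Op ↥Λ q) : ω.toInfVolState.expect Λ A = ω (𝔄.ι Λ A) :=
  rfl

/-- **States of the quasi-local algebra are exactly the compatible families of local states**:
every `InfVolState` is `ω.toInfVolState` for a unique state `ω` of `𝔄` (a compatible family
defines a positive normalised functional on the dense ⋆-subalgebra `𝔄_loc`, bounded by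
`InfVolState.norm_expect_le`, hence extends uniquely). Bratteli–Robinson II §6.2.1;
Bratteli–Robinson I Prop. 2.3.11 (continuity) and §2.6. [cite: BratteliRobinsonII1997, §6.2.1] -/
def existsUnique_state_of_infVolState : Prop :=
  ∀ (𝔄 : QuasiLocalAlgebra d q) (ω : InfVolState d q),
    ∃! Ω : State 𝔄.carrier, Ω.toInfVolState = ω

/-- Translation of states corresponds under `toInfVolState`: `(ω ∘ τ_v)_Λ = shift v (ω_Λ)`
(`shift_ι`). Bratteli–Robinson II §6.2.1, eq. (6.2.2). [folklore] -/
theorem State.toInfVolState_comap_shift {𝔄 : QuasiLocalAlgebra d q}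
    (ω : State 𝔄.carrier) (v : Site d) :
    (ω.comap (𝔄.shift v : 𝔄.carrier →⋆ₐ[ℂ] 𝔄.carrier)).toInfVolState =
      ω.toInfVolState.shift v := by
  ext Λ A
  simp [InfVolState.shift_expect, 𝔄.shift_ι]

/-- A state of `𝔄` is translation invariant iff its family of local states is.
Bratteli–Robinson II §6.2.1. [cite: BratteliRobinsonII1997, §6.2.1] -/
def QuasiLocalAlgebra.isTranslationInvariant_iff : Prop :=
  ∀ (𝔄 : QuasiLocalAlgebra d q) (ω : State 𝔄.carrier),
    𝔄.IsTranslationInvariant ω ↔ ω.toInfVolState.IsTranslationInvariant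

/-! ### Dynamics -/

namespace QuasiLocalAlgebra

variable (𝔄 : QuasiLocalAlgebra d q)

/-- `τ` is **the dynamics generated by the interaction `Φ`** (of finite range `R`) on the
quasi-local algebra: `τ` is a strongly continuous one-parameter group of ⋆-automorphisms whose
generator restricted to the local algebra is the commutator derivation,
`d/dt τ_t(ι_Λ A)|_{t=0} = ι_{Λ_R} (i[H_{Λ_R}, A])` with `Λ_R = thicken Λ R`
(`derivation Φ R Λ A`, item Q13). Since `𝔄_loc` is a core for the generator
(Bratteli–Robinson II Thm. 6.2.4), this determines `τ`. Bratteli–Robinson II Thm. 6.2.4,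
eq. (6.2.9). [folklore] -/
def IsDynamicsOf (τ : ℝ → (𝔄.carrier ≃⋆ₐ[ℂ] 𝔄.carrier)) (Φ : LatticeInteraction d q) (R : ℝ) :
    Prop :=
  IsAutomorphismGroup τ ∧
    ∀ (Λ : Finset (Site d)) (A : Op ↥Λ q),
      HasDerivAt (fun t : ℝ => τ t (𝔄.ι Λ A)) (𝔄.ι (thicken Λ R) (derivation Φ R Λ A)) 0

/-- The dynamics of `Φ` is a strongly continuous automorphism group (by definition).
Bratteli–Robinson II Thm. 6.2.4. [folklore] -/
theorem IsDynamicsOf.isAutomorphismGroup {𝔄 : QuasiLocalAlgebra d q}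
    {τ : ℝ → (𝔄.carrier ≃⋆ₐ[ℂ] 𝔄.carrier)} {Φ : LatticeInteraction d q} {R : ℝ}
    (h : 𝔄.IsDynamicsOf τ Φ R) : IsAutomorphismGroup τ :=
  h.1

/-- **Existence of the dynamics** (Bratteli–Robinson II Thm. 6.2.4): a Hermitian interaction of
finite range `R` with uniformly bounded terms (`‖Φ X‖ ≤ J`; then `‖Φ‖_λ < ∞` for every `λ > 0`)
generates a unique strongly continuous one-parameter group of ⋆-automorphisms `τ` of the
quasi-local algebra with `d/dt τ_t(A)|_0 = i[H_{Λ'}, A]` for local `A`; moreover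
`τ_t(A) = lim_{Λ→ℤ^d} e^{itH_Λ} A e^{-itH_Λ}`. (An `∃!` statement; the name `exists_dynamics`
is the outline's.) [cite: BratteliRobinsonII1997, Thm. 6.2.4] -/
def exists_dynamics : Prop :=
  ∀ (Φ : LatticeInteraction d q) {R J : ℝ} (hH : Φ.IsHermitian) (hR : Φ.HasFiniteRange R)
    (hb : Φ.IsBounded J),
    ∃! τ : ℝ → (𝔄.carrier ≃⋆ₐ[ℂ] 𝔄.carrier), 𝔄.IsDynamicsOf τ Φ R

/-- The dynamics commutes with translations for a translation-invariant interaction: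
`τ_t ∘ shift v = shift v ∘ τ_t`. Bratteli–Robinson II Thm. 6.2.4 / eq. (6.2.11).
[cite: BratteliRobinsonII1997, Thm. 6.2.4 eq. (6.2.11)] -/
def IsDynamicsOf.shift_comm : Prop :=
  ∀ {𝔄 : QuasiLocalAlgebra d q} {τ : ℝ → (𝔄.carrier ≃⋆ₐ[ℂ] 𝔄.carrier)} {Φ : LatticeInteraction d q} {R : ℝ} (h : 𝔄.IsDynamicsOf τ Φ R) (hΦ : Φ.IsTranslationInvariant) (hR : Φ.HasFiniteRange R) (t : ℝ) (v : Site d) (a : 𝔄.carrier),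
    τ t (𝔄.shift v a) = 𝔄.shift v (τ t a)

/-! ### Ground states and the GNS Hamiltonian -/

/-- For the dynamics `τ` of a Hermitian interaction of finite range `R` with uniformly bounded
terms (`‖Φ X‖ ≤ J`, so that `‖Φ‖_λ < ∞` and the local algebra `ι(𝔄_loc)` is a core for the
generator `δ` of `τ`, Bratteli–Robinson II Thm. 6.2.4), the C⋆-algebraic ground-state condition
`-i ω(a⋆ δ(a)) ≥ 0` on `D(δ)` is equivalent to the local criterion of item Q13 on the family of
local states `ω ∘ ι_Λ`. Bratteli–Robinson II Prop. 5.3.19, Thm. 6.2.4 and §6.2.7; Tasaki (2020)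
Def. A.14. [cite: Tasaki2020] -/
def _root_.Literature.MathematicalPhysics.QuantumLattice.State.isGroundState_iff_toInfVolState_isGroundState : Prop :=
  ∀ {τ : ℝ → (𝔄.carrier ≃⋆ₐ[ℂ] 𝔄.carrier)} {Φ : LatticeInteraction d q} {R J : ℝ} (hτ : 𝔄.IsDynamicsOf τ Φ R) (hH : Φ.IsHermitian) (hR : Φ.HasFiniteRange R) (hb : Φ.IsBounded J) (ω : State 𝔄.carrier),
    ω.IsGroundState τ ↔ ω.toInfVolState.IsGroundState Φ R

/-- **The GNS Hamiltonian of a ground state.** If `ω` is a ground state for the strongly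
continuous automorphism group `τ`, there is a unique strongly continuous one-parameter unitary
group `U_ω(t) = e^{itH_ω}` on the GNS space implementing `τ` and fixing `Ω_ω`; its Stone generator
`H_ω = U.hamiltonian` (item C4) is the GNS Hamiltonian, `H_ω ≥ 0` and `H_ω Ω_ω = 0`.
Bratteli–Robinson I Cor. 2.3.17; Bratteli–Robinson II Prop. 5.3.19 (3), Cor. 5.3.20. (An `∃!`
statement; the name `exists_gnsHamiltonian` is the outline's.)
[cite: BratteliRobinsonII1997, Prop. 5.3.19 (3) and Cor. 5.3.20] -/
def exists_gnsHamiltonian : Prop :=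
  ∀ {τ : ℝ → (𝔄.carrier ≃⋆ₐ[ℂ] 𝔄.carrier)} (hτ : IsAutomorphismGroup τ) {ω : State 𝔄.carrier} (hω : ω.IsGroundState τ),
    ∃! U : Literature.Analysis.UnboundedOperators.OneParameterUnitaryGroup ω.gnsSpace,
      ω.IsGNSImplementationOf τ U ∧ U.HasPositiveEnergy

/-- **Bridge to G07 (gapped ground state ⇔ spectral gap of the GNS Hamiltonian).** Let `τ` be the
dynamics of the Hermitian interaction `Φ` of finite range `R` with uniformly bounded terms
(`‖Φ X‖ ≤ J`; then `ι(𝔄_loc)` is a core for the generator, Bratteli–Robinson II Thm. 6.2.4, and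
`π_ω(ι(𝔄_loc)) Ω_ω` is a core for `H_ω`), `ω` a state of `𝔄` and `U` the unitary group
implementing `τ` in the GNS representation of `ω` and fixing `Ω_ω`. Then the local gap
criterion `-i ω(A⋆δ(A)) ≥ γ (ω(A⋆A) - |ω(A)|²)` of item Q13 (`InfVolState.IsGappedGroundState`,
which includes the ground-state condition and `γ > 0`) holds iff the GNS Hamiltonian
`H_ω = U.hamiltonian` is self-adjoint, non-negative, has kernel `ℂ Ω_ω` and
`σ(H_ω) ∖ {0} ⊆ [γ, ∞)` (`LinearPMap.HasGroundStateGap`, G07 `SpectralGap`). Tasaki (2020)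
Def. A.16 and Lemma A.17; Bratteli–Robinson II Prop. 5.3.19, §6.2.7. [cite: Tasaki2020] -/
def isGappedGroundState_iff_hasGroundStateGap : Prop :=
  ∀ {τ : ℝ → (𝔄.carrier ≃⋆ₐ[ℂ] 𝔄.carrier)} {Φ : LatticeInteraction d q} {R J : ℝ} (hτ : 𝔄.IsDynamicsOf τ Φ R) (hH : Φ.IsHermitian) (hR : Φ.HasFiniteRange R) (hb : Φ.IsBounded J) {ω : State 𝔄.carrier} {U : Literature.Analysis.UnboundedOperators.OneParameterUnitaryGroup ω.gnsSpace} (hU : ω.IsGNSImplementationOf τ U) (γ : ℝ),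
    ω.toInfVolState.IsGappedGroundState Φ R γ ↔
      U.hamiltonian.HasGroundStateGap ω.gnsVector γ

end QuasiLocalAlgebra

/-! ### Existence (UHF algebra) -/

/-- **The quasi-local algebra exists**: the C⋆-inductive limit of the directed system of full
matrix algebras `(𝔄_Λ, embedOp)` is a UHF algebra carrying compatible injections `ι_Λ`, locality,
a dense local algebra and the translation automorphisms. Glimm (1960); Bratteli–Robinson I
§2.6.3; Bratteli–Robinson II §6.2.1, eqs. (6.2.1)–(6.2.2). Requires
`q ≥ 1` (for `q = 0` the structure is empty, see the module docstring). [cite: Glimm1960] -/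
def nonempty_quasiLocalAlgebra : Prop :=
  ∀ (d q : ℕ) [NeZero q],
    Nonempty (QuasiLocalAlgebra d q)

end QLattice

end Literature.MathematicalPhysics.QuantumLattice
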